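import Mathlib
import Literature.Computability.AlgebraicComplexity.ValiantClasses
import Literature.Computability.AlgebraicComplexity.ArithCircuitProofs
import Literature.Computability.AlgebraicComplexity.DetInVP

/-!
# Crux `ClassTransfer` (stmt-ValiantsHypothesis-7287), negative side —
# the 2-fermionant `Fer_2 = Σ_σ sgn(σ) 2^{c(σ)} x^σ` is in `VNP`

Lead prover (gen 1) of line `registered`.  Companion of `Negative/Fermionant.lean`
(`ClassTransfer ⇒ Fer_k ∉ VP`).  Here: **`Fer_2 ∈ VNP_ℂ`**, by an explicit Valiant witness —
colouring by colouring, the coefficient `sgn(σ) · #{e : [n] → {0,1} | e ∘ σ = e}` is a Boolean sum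
of determinants:

  `Fer_2(X) = Σ_{e ∈ {0,1}^n} det( x_ij · [e_i = e_j] )`,  `[e_i = e_j] = 1 - e_i - e_j + 2 e_i e_j`,

since `det(x_ij [e_i = e_j]) = Σ_σ sgn(σ) ∏_i x_{σ(i),i} [e(σ i) = e(i)]`.  The witness
`g_n(X, Y) = det( x_ij (1 - y_i - y_j + 2 y_i y_j) ) = DET_n ∘ (cubic substitution)` is in `VP`
(`complexity_aeval_le` + `complexity_detPoly_le`: size `≤ 8(n+1)^7 + 7n²`; `n² + n` variables;
degree `≤ 3n`), so `Fer_2` is p-definable (Bürgisser 2000, Def. 2.5, literally the tree's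
`IsVNPFamily`).  With `Negative/Fermionant.lean` this makes the crux SUMMIT-HARD on its own
(`Negative/SummitHard.lean`: `ClassTransfer → ValiantsHypothesis`).

The coefficient is written with `Fin 2`-valued colourings, as in `Negative/Fermionant.lean` at
`k = 0`.  No definitions (the witness is a term inside the proof).  References: Valiant 1979;
Bürgisser 2000 Def. 2.5, Prop. 2.20 (Valiant's criterion, of which this is the trivial instance
"coefficients given by a determinant"). [folklore]
-/

set_option linter.dupNamespace false

noncomputable section

namespace Summit.ValiantsHypothesis.ValiantsHypothesis.Theorems.ClassTransfer.Negative

open Equiv Finset MvPolynomial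
open Literature.Computability.AlgebraicComplexity

/-- Degree of a determinant with entries of degree `≤ d`. [folklore] -/
theorem totalDegree_det_le_mul {R : Type*} [CommRing R] {τ ι : Type*} [Fintype ι] [DecidableEq ι]
    (N : Matrix ι ι (MvPolynomial τ R)) (d : ℕ) (h : ∀ i j, (N i j).totalDegree ≤ d) :
    N.det.totalDegree ≤ d * Fintype.card ι := by
  rw [Matrix.det_apply']
  refine MvPolynomial.totalDegree_finsetSum_le fun π _ => ?_
  refine (MvPolynomial.totalDegree_mul _ _).trans ?_
  have h1 : (((Equiv.Perm.sign π : ℤˣ) : ℤ) : MvPolynomial τ R).totalDegree = 0 := by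
    rw [← map_intCast (MvPolynomial.C : R →+* MvPolynomial τ R), MvPolynomial.totalDegree_C]
  rw [h1, zero_add]
  refine (MvPolynomial.totalDegree_finsetProd _ _).trans ?_
  calc ∑ i, (N (π i) i).totalDegree ≤ ∑ _i : ι, d := Finset.sum_le_sum fun i _ => h _ _
    _ = d * Fintype.card ι := by simp [mul_comm]

/-- Two-colourings as Booleans or as elements of `Fin 2`: the counts of colourings constant on
the cycles of `σ` agree. [folklore] -/
theorem card_boolColourFix_eq {n : ℕ} (σ : Perm (Fin n)) :
    (univ.filter fun e : Fin n → Bool => ∀ i, e (σ i) = e i).card =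
      (univ.filter fun f : Fin n → Fin 2 => ∀ i, f (σ i) = f i).card := by
  classical
  refine Finset.card_bij (fun e _ => fun i => finTwoEquiv.symm (e i)) ?_ ?_ ?_
  · intro e he
    simp only [Finset.mem_filter, Finset.mem_univ, true_and] at he ⊢
    intro i
    rw [he i]
  · intro e₁ _ e₂ _ h
    funext i
    exact finTwoEquiv.symm.injective (congrFun h i)
  · intro f hf
    refine ⟨fun i => finTwoEquiv (f i), ?_, ?_⟩
    · simp only [Finset.mem_filter, Finset.mem_univ, true_and] at hf ⊢
      intro i
      rw [hf i]
    · funext i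
      simp

/-- **`Fer_2 ∈ VNP`.**  The 2-fermionant family
`n ↦ Σ_σ sgn(σ) · #{f : [n] → [2] | f ∘ σ = f} · ∏ x_{σ(i),i}` (`= Σ_σ sgn(σ) 2^{c(σ)} x^σ`) is
p-definable over `ℂ`: it is the Boolean sum over `e ∈ {0,1}^n` of
`g_n(X, e) = det( x_ij (1 - e_i - e_j + 2 e_i e_j) )`, and `g ∈ VP`. [folklore] -/
theorem isVNPFamily_fermionant_two :
    IsVNPFamily (k := ℂ) (fun n => ∑ σ : Perm (Fin n),
      MvPolynomial.C (((Perm.sign σ : ℤ) : ℂ) *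
          ((univ.filter fun f : Fin n → Fin 2 => ∀ x, f (σ x) = f x).card : ℂ)) *
        ∏ i : Fin n, MvPolynomial.X (σ i, i)) := by
  classical
  -- the mask `1 - y_b - y_c + 2 y_b y_c` and the witness `g_n = DET_n(x_ij · mask_ij)`
  set φ : (n : ℕ) → Fin n × Fin n → MvPolynomial ((Fin n × Fin n) ⊕ Fin n) ℂ := fun n ij =>
    X (Sum.inl ij) * (C (-1) * (X (Sum.inr ij.1) + X (Sum.inr ij.2)) +
      C 2 * (X (Sum.inr ij.1) * X (Sum.inr ij.2)) + C 1) with hφ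
  set g : (n : ℕ) → MvPolynomial ((Fin n × Fin n) ⊕ Fin n) ℂ := fun n =>
    aeval (φ n) (detPoly (Fin n) ℂ) with hg
  -- degree and size of the mask entries
  have hdegφ : ∀ n ij, (φ n ij).totalDegree ≤ 3 := by
    intro n ij
    simp only [hφ]
    refine (totalDegree_mul _ _).trans ?_
    have hX : ∀ v : (Fin n × Fin n) ⊕ Fin n,
        (X v : MvPolynomial ((Fin n × Fin n) ⊕ Fin n) ℂ).totalDegree ≤ 1 := fun v => by
      rw [totalDegree_X]
    have hCle : ∀ c : ℂ, ∀ p : MvPolynomial ((Fin n × Fin n) ⊕ Fin n) ℂ,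
        (C c * p).totalDegree ≤ p.totalDegree := fun c p =>
      (totalDegree_mul _ _).trans (by rw [totalDegree_C, zero_add])
    have h1 : (X (Sum.inr ij.1) + X (Sum.inr ij.2) :
        MvPolynomial ((Fin n × Fin n) ⊕ Fin n) ℂ).totalDegree ≤ 1 :=
      (totalDegree_add _ _).trans (max_le (hX _) (hX _))
    have h2 : (X (Sum.inr ij.1) * X (Sum.inr ij.2) :
        MvPolynomial ((Fin n × Fin n) ⊕ Fin n) ℂ).totalDegree ≤ 2 :=
      (totalDegree_mul _ _).trans (Nat.add_le_add (hX _) (hX _))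
    have h3 : (C (-1) * (X (Sum.inr ij.1) + X (Sum.inr ij.2)) +
        C 2 * (X (Sum.inr ij.1) * X (Sum.inr ij.2)) + C 1 :
        MvPolynomial ((Fin n × Fin n) ⊕ Fin n) ℂ).totalDegree ≤ 2 := by
      refine (totalDegree_add _ _).trans (max_le ?_ (by rw [totalDegree_C]; omega))
      refine (totalDegree_add _ _).trans (max_le ((hCle _ _).trans (h1.trans (by omega)))
        ((hCle _ _).trans h2))
    have := hX (Sum.inl ij)
    omega
  have hcφ : ∀ n ij, complexity (φ n ij) ≤ 7 := by
    intro n ij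
    simp only [hφ]
    have hX : ∀ v : (Fin n × Fin n) ⊕ Fin n,
        complexity (X v : MvPolynomial ((Fin n × Fin n) ⊕ Fin n) ℂ) = 0 := complexity_X_holds
    have hC : ∀ c : ℂ, complexity (C c : MvPolynomial ((Fin n × Fin n) ⊕ Fin n) ℂ) = 0 :=
      complexity_C_holds
    have h1 := complexity_add_le_holds (X (Sum.inr ij.1) : MvPolynomial ((Fin n × Fin n) ⊕ Fin n) ℂ)
      (X (Sum.inr ij.2))
    have h2 := complexity_mul_le_holds (C (-1) : MvPolynomial ((Fin n × Fin n) ⊕ Fin n) ℂ)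
      (X (Sum.inr ij.1) + X (Sum.inr ij.2))
    have h3 := complexity_mul_le_holds (X (Sum.inr ij.1) : MvPolynomial ((Fin n × Fin n) ⊕ Fin n) ℂ)
      (X (Sum.inr ij.2))
    have h4 := complexity_mul_le_holds (C 2 : MvPolynomial ((Fin n × Fin n) ⊕ Fin n) ℂ)
      (X (Sum.inr ij.1) * X (Sum.inr ij.2))
    have h5 := complexity_add_le_holds (C (-1) * (X (Sum.inr ij.1) + X (Sum.inr ij.2)) :
      MvPolynomial ((Fin n × Fin n) ⊕ Fin n) ℂ) (C 2 * (X (Sum.inr ij.1) * X (Sum.inr ij.2)))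
    have h6 := complexity_add_le_holds (C (-1) * (X (Sum.inr ij.1) + X (Sum.inr ij.2)) +
      C 2 * (X (Sum.inr ij.1) * X (Sum.inr ij.2)) : MvPolynomial ((Fin n × Fin n) ⊕ Fin n) ℂ) (C 1)
    have h7 := complexity_mul_le_holds (X (Sum.inl ij) : MvPolynomial ((Fin n × Fin n) ⊕ Fin n) ℂ)
      (C (-1) * (X (Sum.inr ij.1) + X (Sum.inr ij.2)) +
        C 2 * (X (Sum.inr ij.1) * X (Sum.inr ij.2)) + C 1)
    rw [hX, hX] at h1
    rw [hC] at h2 h4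
    rw [hX, hX] at h3
    rw [hC] at h6
    rw [hX] at h7
    omega
  -- the witness expands to a determinant with the mask entries
  have hgdet : ∀ n, g n = (Matrix.of fun i j : Fin n => φ n (i, j)).det := by
    intro n
    simp only [hg, detPoly]
    rw [AlgHom.map_det]
    congr 1
    ext i j
    simp [AlgHom.mapMatrix_apply, Matrix.map_apply, Matrix.mvPolynomialX]
  refine ⟨⟨(IsPBounded.iff_exists_le_mul_succ_pow _).2 ⟨1, 2, fun n => ?_⟩,
      (IsPBounded.iff_exists_le_mul_succ_pow _).2 ⟨1, 1, fun n => ?_⟩⟩,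
    fun n => n, g, ⟨⟨(IsPBounded.iff_exists_le_mul_succ_pow _).2 ⟨1, 2, fun n => ?_⟩,
      (IsPBounded.iff_exists_le_mul_succ_pow _).2 ⟨3, 1, fun n => ?_⟩⟩,
      (IsPBounded.iff_exists_le_mul_succ_pow _).2 ⟨15, 7, fun n => ?_⟩⟩, fun n => ?_⟩
  · -- variables of `Fer_2`
    have h : 1 * (n + 1) ^ 2 = n * n + 2 * n + 1 := by ring
    simp only [Fintype.card_prod, Fintype.card_fin]
    omega
  · -- degree of `Fer_2`: `≤ n`
    dsimp only
    rw [pow_one]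
    refine (MvPolynomial.totalDegree_finsetSum_le fun σ _ => ?_).trans (by omega : n ≤ 1 * (n + 1))
    refine (totalDegree_mul _ _).trans ?_
    rw [totalDegree_C, zero_add]
    refine (totalDegree_finsetProd _ _).trans ?_
    calc ∑ i : Fin n, (X (σ i, i) : MvPolynomial (Fin n × Fin n) ℂ).totalDegree
        ≤ ∑ _i : Fin n, 1 := Finset.sum_le_sum fun i _ => by rw [totalDegree_X]
      _ = n := by simp
  · -- variables of the witness
    have h : 1 * (n + 1) ^ 2 = n * n + 2 * n + 1 := by ring
    simp only [Fintype.card_sum, Fintype.card_prod, Fintype.card_fin]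
    omega
  · -- degree of the witness: `≤ 3 n`
    dsimp only
    rw [pow_one, hgdet n]
    refine (totalDegree_det_le_mul _ 3 fun i j => ?_).trans (by rw [Fintype.card_fin]; omega)
    rw [Matrix.of_apply]
    exact hdegφ n (i, j)
  · -- size of the witness: `≤ L(DET_n) + Σ L(mask entries) ≤ 8(n+1)^7 + 7 n²`
    dsimp only
    have h1 := complexity_aeval_le (detPoly (Fin n) ℂ) (φ n)
    have h2 := complexity_detPoly_le ℂ n
    have h3 : ∑ ij : Fin n × Fin n, complexity (φ n ij) ≤ 7 * (n * n) :=
      calc ∑ ij : Fin n × Fin n, complexity (φ n ij) ≤ ∑ _ij : Fin n × Fin n, 7 :=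
            Finset.sum_le_sum fun ij _ => hcφ n ij
        _ = 7 * (n * n) := by simp [mul_comm]
    have h4 : n * n ≤ (n + 1) ^ 7 :=
      calc n * n ≤ (n + 1) ^ 2 := by nlinarith
        _ ≤ (n + 1) ^ 7 := Nat.pow_le_pow_right (Nat.succ_pos n) (by omega)
    change complexity (aeval (φ n) (detPoly (Fin n) ℂ)) ≤ _
    omega
  · -- the Boolean sum of the witness is `Fer_2`
    dsimp only
    unfold boolSum
    simp only [hg]
    -- substitute the Boolean point into the mask: `x_ij · [e_i = e_j]`
    have hmask : ∀ (e : Fin n → Bool) (ij : Fin n × Fin n),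
        aeval (Sum.elim X fun j => if e j then (1 : MvPolynomial (Fin n × Fin n) ℂ) else 0)
          (φ n ij) = X ij * C (if e ij.1 = e ij.2 then (1 : ℂ) else 0) := by
      intro e ij
      simp only [hφ, map_mul, map_add, map_neg, map_one, map_ofNat, aeval_X,
        Sum.elim_inl, Sum.elim_inr]
      (cases e ij.1 <;> cases e ij.2 <;> simp); ring
    have hsub : ∀ e : Fin n → Bool,
        aeval (Sum.elim X fun j => if e j then (1 : MvPolynomial (Fin n × Fin n) ℂ) else 0)
          (aeval (φ n) (detPoly (Fin n) ℂ)) =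
        ∑ σ : Perm (Fin n), ((Perm.sign σ : ℤ) : MvPolynomial (Fin n × Fin n) ℂ) *
          ((∏ i : Fin n, X (σ i, i)) * C (if (∀ i, e (σ i) = e i) then (1 : ℂ) else 0)) := by
      intro e
      rw [comp_aeval_apply]
      simp only [hmask, detPoly]
      rw [AlgHom.map_det, Matrix.det_apply']
      refine Finset.sum_congr rfl fun σ _ => ?_
      congr 1
      have hent : ∀ i : Fin n, ((aeval fun ij : Fin n × Fin n =>
          (X ij * C (if e ij.1 = e ij.2 then (1 : ℂ) else 0) : MvPolynomial (Fin n × Fin n) ℂ)).mapMatrix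
            (Matrix.mvPolynomialX (Fin n) (Fin n) ℂ)) (σ i) i =
          X (σ i, i) * C (if e (σ i) = e i then (1 : ℂ) else 0) := by
        intro i
        simp [AlgHom.mapMatrix_apply, Matrix.map_apply, Matrix.mvPolynomialX]
      rw [Finset.prod_congr rfl fun i _ => hent i, Finset.prod_mul_distrib, ← map_prod]
      congr 2
      by_cases h : ∀ i, e (σ i) = e i
      · rw [if_pos h]
        exact Finset.prod_eq_one fun i _ => if_pos (h i)
      · rw [if_neg h]
        push Not at h
        obtain ⟨i, hi⟩ := h
        exact Finset.prod_eq_zero (Finset.mem_univ i) (if_neg hi)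
    simp only [hsub]
    rw [Finset.sum_comm]
    refine Finset.sum_congr rfl fun σ _ => ?_
    -- collect the colouring count
    rw [← Finset.mul_sum, ← Finset.mul_sum, ← map_sum]
    have hcount : (∑ e : Fin n → Bool, (if (∀ i, e (σ i) = e i) then (1 : ℂ) else 0)) =
        ((univ.filter fun f : Fin n → Fin 2 => ∀ x, f (σ x) = f x).card : ℂ) := by
      rw [Finset.sum_boole, card_boolColourFix_eq σ]
    rw [hcount, ← map_intCast (MvPolynomial.C : ℂ →+* MvPolynomial (Fin n × Fin n) ℂ),
      mul_comm (∏ i, X (σ i, i)) _, ← mul_assoc, ← map_mul]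

end Summit.ValiantsHypothesis.ValiantsHypothesis.Theorems.ClassTransfer.Negative
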